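import Summits.Parity.BatemanHorn.Theorems.AlmostPrimeZerosSystemZeroRepulsionShiftTiltedCore

/-!
# Crux `SystemZeroRepulsion` (stmt-Parity-11291), line `smooth-rough-lattice-acquisition` (reshaped,
lead c2): stub `stub_shiftTiltedMajorant` — the tilted majorant of the SHIFTED capped statistic

Calibration class `k = 1`, `f = X + h` of the crux, part 2 of 2.  With `s(m) = Σ_{p^v ∥ m} min(v,2)`
(`s(0) = 0`) and `P_y(z) = Σ_{0 ≤ m ≤ y} z^{s(m)}` the almost-prime polynomial of `f = X`, the system
polynomial of `f = X + h` is `S^{(h)}_x(z) = Σ_{0 ≤ n ≤ x} z^{s((n+h)⁺)}`, and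
`S^{(h)}_x = P_{x+h} − P_{h−1}` (`h ≥ 0`), `S^{(h)}_x = |h| + P_{x−|h|}` (`h < 0`, `x ≥ |h|`).  So the landed
transfer `stub_shiftCore` (part 1) applies with a perturbation of modulus `≤ (|h|+1)·e^{d_h(1+‖z−1‖)}`,
`d_h = Σ_{m ≤ |h|} s(m)`.  Everything here is PROVED.
-/

noncomputable section

namespace Summit.Parity.BatemanHorn.Cruxes.SystemZeroRepulsion.NearFar

open scoped BigOperators
open Summit.Parity.BatemanHorn.Cruxes.LinearCappedRepulsion.JensenStieltjesMajorant

/-! ### The perturbation identities -/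

/-- **Perturbation bound, nonnegative shift.**  For `H : ℕ`,
`‖Σ_{n≤x} z^{s(n+H)} − Σ_{m ≤ x+H} z^{s(m)}‖ ≤ (H+1)·exp(d_H (1+‖z−1‖))`, `d_H = Σ_{m ≤ H} s(m)`:
the difference is `−Σ_{m<H} z^{s(m)}`. -/
private theorem shift_perturb_nonneg (x H : ℕ) (z : ℂ) :
    ‖(∑ n ∈ Finset.range (x + 1), z ^ ((n + H).factorization.sum fun _ v => min v 2)) -
        ∑ m ∈ Finset.range (x + H + 1), z ^ (m.factorization.sum fun _ v => min v 2)‖ ≤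
      ((H : ℝ) + 1) * Real.exp ((∑ m ∈ Finset.range (H + 1), ((m.factorization.sum fun _ v => min v 2 : ℕ) : ℝ)) *
        (1 + ‖z - 1‖)) := by
  set g : ℕ → ℂ := fun m => z ^ (m.factorization.sum fun _ v => min v 2) with hg
  -- `Σ_{n ≤ x} g(n+H) = Σ_{m ∈ Ico H (x+H+1)} g m`
  have h1 : ∑ n ∈ Finset.range (x + 1), z ^ ((n + H).factorization.sum fun _ v => min v 2) =
      ∑ m ∈ Finset.Ico H (x + H + 1), g m := by
    rw [Finset.sum_Ico_eq_sum_range]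
    have : x + H + 1 - H = x + 1 := by omega
    rw [this]
    refine Finset.sum_congr rfl fun n _ => ?_
    simp [hg, add_comm]
  -- `Σ_{m ≤ x+H} g m = Σ_{m < H} g m + Σ_{m ∈ Ico H (x+H+1)} g m`
  have h2 : ∑ m ∈ Finset.range (x + H + 1), g m =
      ∑ m ∈ Finset.range H, g m + ∑ m ∈ Finset.Ico H (x + H + 1), g m := by
    rw [Finset.range_eq_Ico, Finset.range_eq_Ico]
    exact (Finset.sum_Ico_consecutive g (Nat.zero_le H) (by omega)).symm
  have h3 : (∑ n ∈ Finset.range (x + 1), z ^ ((n + H).factorization.sum fun _ v => min v 2)) -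
      ∑ m ∈ Finset.range (x + H + 1), z ^ (m.factorization.sum fun _ v => min v 2) =
        -∑ m ∈ Finset.range H, g m := by
    rw [h1]
    change _ - ∑ m ∈ Finset.range (x + H + 1), g m = _
    rw [h2]
    ring
  rw [h3, norm_neg]
  -- bound the short sum
  have hd0 : (0 : ℝ) ≤ ∑ m ∈ Finset.range (H + 1), ((m.factorization.sum fun _ v => min v 2 : ℕ) : ℝ) :=
    Finset.sum_nonneg fun m _ => by positivity
  have hd : ∀ n ∈ Finset.range H, ((n.factorization.sum fun _ v => min v 2 : ℕ) : ℝ) ≤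
      ∑ m ∈ Finset.range (H + 1), ((m.factorization.sum fun _ v => min v 2 : ℕ) : ℝ) := by
    intro n hn
    have hn' : n ∈ Finset.range (H + 1) := by
      rw [Finset.mem_range] at hn ⊢; omega
    exact Finset.single_le_sum (f := fun m : ℕ => ((m.factorization.sum fun _ v => min v 2 : ℕ) : ℝ))
      (fun m _ => by positivity) hn'
  have h := shift_norm_sum_pow_le (Finset.range H) (fun m => m.factorization.sum fun _ v => min v 2) hd0 hd z
  rw [Finset.card_range] at h
  refine h.trans ?_
  have hexp : 0 ≤ Real.exp ((∑ m ∈ Finset.range (H + 1), ((m.factorization.sum fun _ v => min v 2 : ℕ) : ℝ)) *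
      (1 + ‖z - 1‖)) := (Real.exp_pos _).le
  nlinarith

/-- **Perturbation bound, negative shift.**  For `H : ℕ`, the statistic of `f = X − H` is `s(n ∸ H)`
(truncated subtraction, `s(0) = 0`), and `‖Σ_{n≤x} z^{s(n ∸ H)} − Σ_{m ≤ x ∸ H} z^{s(m)}‖ ≤ H`:
for `x ≥ H` the difference is the constant `H` (the `H` values `n < H`, each contributing `z⁰ = 1`),
for `x < H` it is the constant `x`. -/
private theorem shift_perturb_neg (x H : ℕ) (z : ℂ) :
    ‖(∑ n ∈ Finset.range (x + 1), z ^ ((n - H).factorization.sum fun _ v => min v 2)) -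
        ∑ m ∈ Finset.range (x - H + 1), z ^ (m.factorization.sum fun _ v => min v 2)‖ ≤ (H : ℝ) := by
  set g : ℕ → ℂ := fun m => z ^ (m.factorization.sum fun _ v => min v 2) with hg
  have hg0 : g 0 = 1 := by simp [hg]
  rcases le_or_gt H x with hHx | hHx
  · -- `x ≥ H`: split `range (x+1)` at `H`
    have hsplit : ∑ n ∈ Finset.range (x + 1), z ^ ((n - H).factorization.sum fun _ v => min v 2) =
        ∑ n ∈ Finset.range H, g (n - H) + ∑ n ∈ Finset.Ico H (x + 1), g (n - H) := by
      rw [Finset.range_eq_Ico, Finset.range_eq_Ico]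
      exact (Finset.sum_Ico_consecutive (fun n => g (n - H)) (Nat.zero_le H) (by omega)).symm
    have hfirst : ∑ n ∈ Finset.range H, g (n - H) = (H : ℂ) := by
      rw [Finset.sum_congr rfl (g := fun _ => (1 : ℂ)) (fun n hn => by
        rw [Finset.mem_range] at hn
        rw [Nat.sub_eq_zero_of_le hn.le, hg0])]
      simp
    have hsecond : ∑ n ∈ Finset.Ico H (x + 1), g (n - H) = ∑ m ∈ Finset.range (x - H + 1), g m := by
      rw [Finset.sum_Ico_eq_sum_range]
      have : x + 1 - H = x - H + 1 := by omega
      rw [this]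
      refine Finset.sum_congr rfl fun n _ => ?_
      congr 1
      omega
    rw [hsplit, hfirst, hsecond]
    simp
  · -- `x < H`: every term is `1`, and `x - H = 0`
    have hxH : x - H = 0 := by omega
    have hall : ∑ n ∈ Finset.range (x + 1), z ^ ((n - H).factorization.sum fun _ v => min v 2) =
        ((x : ℂ) + 1) := by
      rw [Finset.sum_congr rfl (g := fun _ => (1 : ℂ)) (fun n hn => by
        rw [Finset.mem_range] at hn
        have : n - H = 0 := by omega
        rw [this]; simp)]
      simp
    rw [hall, hxH]
    simp only [zero_add, Finset.range_one, Finset.sum_singleton]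
    rw [hg0]
    have : ((x : ℂ) + 1) - 1 = (x : ℂ) := by ring
    rw [this, Complex.norm_natCast]
    exact_mod_cast hHx.le

/-! ### The stub -/

/-- **Stub `stub_shiftTiltedMajorant`** (class `k = 1`, `f = X + h` of the crux `SystemZeroRepulsion`,
line `smooth-rough-lattice-acquisition` reshaped): for every `h ∈ ℤ` there are `A ≥ 0`, `C > 0`, `x₀`
with `‖Σ_{0≤n≤x} z^{s((n+h)⁺)}‖ ≤ (x+1)·exp(log log x·(Re z − 1) + A(1+‖z−1‖)^{3/2})` for all
`x ≥ x₀` and `‖z − 1‖ ≤ log log x / C`.  Proof: `stub_shiftCore` (part 1) with the perturbation identities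
`shift_perturb_nonneg` (`h = H ≥ 0`, `x' = x + H`) and `shift_perturb_neg` (`h = −H`, `x' = x ∸ H`,
statistic `s(n ∸ H)`). -/
theorem stub_shiftTiltedMajorant :
    ∀ h : ℤ, ∃ A : ℝ, 0 ≤ A ∧ ∃ C : ℝ, 0 < C ∧ ∃ x₀ : ℕ, ∀ x : ℕ, x₀ ≤ x → ∀ z : ℂ,
      ‖z - 1‖ ≤ Real.log (Real.log x) / C →
      ‖∑ n ∈ Finset.range (x + 1), z ^ ((((n : ℤ) + h).toNat).factorization.sum fun _ v => min v 2)‖ ≤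
        ((x : ℝ) + 1) * Real.exp (Real.log (Real.log x) * (z.re - 1) + A * (1 + ‖z - 1‖) ^ (3 / 2 : ℝ)) := by
  intro h
  obtain ⟨H, rfl | rfl⟩ := Int.eq_nat_or_neg h
  · -- `h = H ≥ 0`
    set d : ℝ := ∑ m ∈ Finset.range (H + 1), ((m.factorization.sum fun _ v => min v 2 : ℕ) : ℝ) with hddef
    have hd0 : 0 ≤ d := Finset.sum_nonneg fun m _ => by positivity
    obtain ⟨A, hA, C, hC, x₀, hmaj⟩ := stub_shiftCore (fun n : ℕ => (n + H).factorization.sum fun _ v => min v 2)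
      (fun x => x + H) H ((H : ℝ) + 1) d le_rfl hd0 (fun x => by omega) (fun x => le_rfl)
      (fun x z => shift_perturb_nonneg x H z)
    refine ⟨A, hA, C, hC, x₀, fun x hx z hz => ?_⟩
    have key : ∀ n : ℕ, (((n : ℤ) + (H : ℤ)).toNat) = n + H := fun n => by
      rw [← Nat.cast_add, Int.toNat_natCast]
    simp only [key]
    exact hmaj x hx z hz
  · -- `h = -H`
    obtain ⟨A, hA, C, hC, x₀, hmaj⟩ := stub_shiftCore (fun n : ℕ => (n - H).factorization.sum fun _ v => min v 2)
      (fun x => x - H) H ((H : ℝ) + 1) 0 le_rfl le_rfl (fun x => by omega) (fun x => by omega)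
      (fun x z => (shift_perturb_neg x H z).trans (by
        have : (0 : ℝ) ≤ Real.exp (0 * (1 + ‖z - 1‖)) := (Real.exp_pos _).le
        nlinarith [Real.one_le_exp (show (0:ℝ) ≤ 0 * (1 + ‖z - 1‖) by simp)]))
    refine ⟨A, hA, C, hC, x₀, fun x hx z hz => ?_⟩
    have key : ∀ n : ℕ, (((n : ℤ) + -(H : ℤ)).toNat) = n - H := fun n => by
      rw [← sub_eq_add_neg, Int.toNat_sub]
    simp only [key]
    exact hmaj x hx z hz

end Summit.Parity.BatemanHorn.Cruxes.SystemZeroRepulsion.NearFar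

end
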